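import Summits.KontsevichZagierPeriods.KontsevichZagierPeriods.Theses.CompiledSubstitutions
import Summits.KontsevichZagierPeriods.KontsevichZagierPeriods.Theorems.HurwitzMicroSectorsHurwitzSectorComplementStubLadderDescentAlgebra

/-!
# `ZetaEvenBKC` (stmt-KontsevichZagierPeriods-3382, route CompiledSubstitutions) from the even-zeta
# descent of the Chebyshev ladder (crux `HurwitzSectorComplement`, line `chebyshev-level-deformation`)

Euler's `ζ(2k) ∈ ℚ·π^{2k}` INSIDE the Kontsevich–Zagier calculus, for every `k ≥ 1`:
`[(0,1)^{2k}, 1/(1 − ∏ xᵢ²)] ~ [(0,1)^{2k}, q · ∏ 1/(1+xᵢ²)]` for some `q ∈ ℚ` — the statement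
`ZetaEvenBKC` of route CompiledSubstitutions — follows from the even-weight descent
`[(0,1)^w, 1/(1−t)] ∈ ℚ·𝔭_w` (`t = ∏ xᵢ`, `𝔭_w = [(0,1)^w, ∏ 2/(1+xᵢ²)]`), which the Chebyshev ladder
of line `chebyshev-level-deformation` proves for every even `w ≥ 2` (conclusion (C) of its stub
`stub_ladderDescent`). The passage `1/(1−t²) ↔ 1/(1−t)` is level-2 bookkeeping with the landed sector
family `σ` of `symReduction_kit` (`σ P = [box, P(t)/(1−t²)]`): `1/(1−t²) = σ(1)`, `1/(1−t) = σ(1+X)`,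
the `m = 2` dilation `(1+X) ≡ 2^w X` in the kit's kernel, integrand additivity `σ(1+X) = σ(1) + σ(X)`,
and division by `2^w` (torsion-freeness). Here the descent enters as a hypothesis
(`zetaEvenBKC_of_descent`); it is discharged by the landed descent theorem in the companion file.
References: F. Beukers, J. Kolk, E. Calabi (1993); M. Kontsevich, D. Zagier, *Periods* (2001), §1.2.
-/

noncomputable section

open Set MeasureTheory Polynomial
open scoped BigOperators
open Literature.NumberTheory.Transcendental

namespace Summit.KontsevichZagierPeriods.Theorems.HurwitzMicroSectorsHurwitzSectorComplement

namespace ZetaEvenBKC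

open Summit.KontsevichZagierPeriods.Theorems.HurwitzMicroSectorsHurwitzSectorComplement.LadderDescent

/-- **Level-2 bookkeeping.** If `[(0,1)^w, 1/(1−t)] ∈ ℚ·𝔭_w` then `[(0,1)^w, 1/(1−t²)] ∈ ℚ·𝔭_w`
(`w ≥ 2`): with `σ P = [box, P(t)/(1−t²)]`, `σ(1+X) = [1/(1−t)]`, `σ(1+X) ≡ 2^w σ(X)` (dilation) and
`σ(1) = σ(1+X) − σ(X)`. [cite: KontsevichZagier2001, §1.2 rules (1), (2)] -/
theorem inQP_one_sub_sq {w : ℕ} (hw : 2 ≤ w)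
    (hD : ∀ (r : KZ.IntegralRep w), r.domain = {x | ∀ i, x i ∈ Set.Ioo (0:ℝ) 1} →
      Set.EqOn r.integrand (fun x => 1 / (1 - ∏ i, x i)) r.domain →
      ∃ q : ℚ, ∀ (s : KZ.IntegralRep w), s.domain = {x | ∀ i, x i ∈ Set.Ioo (0:ℝ) 1} →
        Set.EqOn s.integrand (fun x => (q : ℝ) * ∏ i, 2 / (1 + (x i) ^ 2)) s.domain →
        KZ.Equivalent r s)
    (r : KZ.IntegralRep w) (hrd : r.domain = {x | ∀ i, x i ∈ Set.Ioo (0:ℝ) 1})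
    (hri : Set.EqOn r.integrand (fun x => 1 / (1 - (∏ i, x i) ^ 2)) r.domain) :
    ∃ q : ℚ, ∀ (s : KZ.IntegralRep w), s.domain = {x | ∀ i, x i ∈ Set.Ioo (0:ℝ) 1} →
      Set.EqOn s.integrand (fun x => (q : ℝ) * ∏ i, 2 / (1 + (x i) ^ 2)) s.domain →
      KZ.Equivalent r s := by
  obtain ⟨σ, K, hσd, hσi, hσr, hK, hK5, -⟩ := SymReduction.symReduction_kit w 2 hw (by norm_num)
  have H : (∀ P, (σ P).domain = {x | ∀ i, x i ∈ Set.Ioo (0:ℝ) 1}) ∧ ∀ (P : ℚ[X]) (x : Fin w → ℝ),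
      (σ P).integrand x = Polynomial.aeval (∏ i, x i) P / (1 - (∏ i, x i) ^ 2) := ⟨hσd, hσi⟩
  have hbox : ∀ x : Fin w → ℝ, x ∈ {x : Fin w → ℝ | ∀ i, x i ∈ Set.Ioo (0:ℝ) 1} →
      0 < ∏ i, x i ∧ ∏ i, x i < 1 := by
    intro x hx
    refine ⟨Finset.prod_pos fun i _ => (hx i).1, ?_⟩
    have hw0 : w ≠ 0 := by omega
    calc ∏ i, x i < ∏ _i : Fin w, (1:ℝ) :=
          Finset.prod_lt_prod_of_nonempty (fun i _ => (hx i).1) (fun i _ => (hx i).2)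
            (Finset.univ_nonempty_iff.mpr (Fin.pos_iff_nonempty.mp (Nat.pos_of_ne_zero hw0)))
      _ = 1 := by simp
  -- `r ~ σ 1`
  have hr1 : KZ.Equivalent r (σ 1) := hσr r 1 hrd fun x hx => by
    rw [hri hx]
    simp
  -- `[1/(1−t)] = σ (1 + X)` lies in `ℚ·𝔭_w`
  have h1X : ∃ q : ℚ, ∀ (s : KZ.IntegralRep w), s.domain = {x | ∀ i, x i ∈ Set.Ioo (0:ℝ) 1} →
      Set.EqOn s.integrand (fun x => (q : ℝ) * ∏ i, 2 / (1 + (x i) ^ 2)) s.domain →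
      KZ.Equivalent (σ (1 + X)) s := by
    refine hD (σ (1 + X)) (hσd _) fun x hx => ?_
    rw [hσd] at hx
    obtain ⟨h0, h1⟩ := hbox x hx
    rw [hσi]
    simp only [map_add, map_one, Polynomial.aeval_X]
    have hne : (1 : ℝ) - ∏ i, x i ≠ 0 := by linarith
    have hne2 : (1 : ℝ) - (∏ i, x i) ^ 2 ≠ 0 := by
      have : (1 : ℝ) - (∏ i, x i) ^ 2 = (1 - ∏ i, x i) * (1 + ∏ i, x i) := by ring
      rw [this]
      exact mul_ne_zero hne (by linarith)
    rw [div_eq_div_iff hne2 hne]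
    ring
  -- the dilation: `σ(1+X) ≡ 2^w • σ(X)`
  have hX : ∃ q : ℚ, ∀ (s : KZ.IntegralRep w), s.domain = {x | ∀ i, x i ∈ Set.Ioo (0:ℝ) 1} →
      Set.EqOn s.integrand (fun x => (q : ℝ) * ∏ i, 2 / (1 + (x i) ^ 2)) s.domain →
      KZ.Equivalent (σ X) s := by
    have k := hK5 2 1 0 (by norm_num) (by norm_num)
    have hmem : (1 + X : ℚ[X]) - C ((2 ^ w : ℕ) : ℚ) * X ∈ K := by
      convert k using 1
      simp [Finset.sum_range_succ]
    have hKeq := hK _ _ hmem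
    have hns := sigma_nsmul_mem H (2 ^ w) X
    refine inQP_of_nsmul (N := 2 ^ w) (M := 1) (by positivity) ?_ h1X
    unfold KZ.Equivalent at hKeq
    rw [one_nsmul]
    convert KZ.relations.sub_mem hns hKeq using 1
    abel
  -- `σ 1 = σ(1+X) − σ X`
  have h1 : ∃ q : ℚ, ∀ (s : KZ.IntegralRep w), s.domain = {x | ∀ i, x i ∈ Set.Ioo (0:ℝ) 1} →
      Set.EqOn s.integrand (fun x => (q : ℝ) * ∏ i, 2 / (1 + (x i) ^ 2)) s.domain →
      KZ.Equivalent (σ 1) s := by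
    have hadd := sigma_add_mem H 1 X
    refine inQP_of_rel ?_ h1X hX
    convert KZ.relations.neg_mem hadd using 1
    abel
  exact inQP_of_equivalent hr1 h1

end ZetaEvenBKC

open ZetaEvenBKC LadderDescent in
/-- **`ZetaEvenBKC` from the even-zeta descent of the Chebyshev ladder.** For every `k ≥ 1` there is
`q ∈ ℚ` with `[(0,1)^{2k}, 1/(1 − ∏ xᵢ²)] ~ [(0,1)^{2k}, q ∏ 1/(1+xᵢ²)]`, given the descent
`[(0,1)^w, 1/(1−t)] ∈ ℚ·𝔭_w` for even `w ≥ 2`. [cite: KontsevichZagier2001, §1.2] -/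
theorem zetaEvenBKC_of_descent : (∀ (w : ℕ), 2 ≤ w → Even w → ∀ (r : KZ.IntegralRep w), r.domain = {x | ∀ i, x i ∈ Set.Ioo (0:ℝ) 1} → Set.EqOn r.integrand (fun x => 1 / (1 - ∏ i, x i)) r.domain → ∃ q : ℚ, ∀ (s : KZ.IntegralRep w), s.domain = {x | ∀ i, x i ∈ Set.Ioo (0:ℝ) 1} → Set.EqOn s.integrand (fun x => (q : ℝ) * ∏ i, 2 / (1 + (x i) ^ 2)) s.domain → KZ.Equivalent r s) → Summit.KontsevichZagierPeriods.KontsevichZagierPeriods.Theses.CompiledSubstitutions.ZetaEvenBKC := by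
  intro hD k hk
  have hw : 2 ≤ 2 * k := by omega
  -- a fixed representative of `[box, 1/(1−t²)]` in dimension `2k`
  obtain ⟨σ, _K, hσd, hσi, -, -⟩ := SymReduction.symReduction_kit (2 * k) 2 hw (by norm_num)
  have hρi : Set.EqOn (σ 1).integrand (fun x => 1 / (1 - (∏ i, x i) ^ 2)) (σ 1).domain := by
    intro x _
    rw [hσi]
    simp
  obtain ⟨q, hq⟩ := inQP_one_sub_sq hw (hD (2 * k) hw (even_two_mul k)) (σ 1) (hσd 1) hρi
  refine ⟨q * 2 ^ (2 * k), fun r r' hrd hri hr'd hr'i => ?_⟩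
  -- `r ~ σ 1` (same domain, same integrand on it)
  have hr : KZ.Equivalent r (σ 1) :=
    KZ.of_sub_of_mem_relations_of_eqOn (by rw [hσd, hrd]) fun x hx => by
      rw [hri hx, hσi]
      simp [Finset.prod_pow]
  -- `r'` is pinned to `q ∏ 2/(1+xᵢ²)`
  have hr' : KZ.Equivalent (σ 1) r' := by
    refine hq r' hr'd fun x hx => ?_
    rw [hr'i hx]
    push_cast
    rw [mul_assoc]
    congr 1
    rw [← Fin.prod_const (2 * k) (2:ℝ), ← Finset.prod_mul_distrib]
    refine Finset.prod_congr rfl fun i _ => ?_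
    ring
  exact hr.trans hr'

end Summit.KontsevichZagierPeriods.Theorems.HurwitzMicroSectorsHurwitzSectorComplement

end
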